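import Summits.AtomisticToContinuum.HydrodynamicLimit.Theorems.CollisionIsometryCLTMacroClosureEngineDefs
import Summits.AtomisticToContinuum.HydrodynamicLimit.Theorems.CollisionIsometryCLTMacroClosureStubClausiusStatics
import Summits.AtomisticToContinuum.HydrodynamicLimit.Theorems.CollisionIsometryCLTMacroClosureStubBalanceB1
import HarnessLib

/-!
# Sub-goal `engine_aeDistinct` of the stub `stub_engine` (line `IdeatorTwoGen1Sketch`, crux `MacroClosure`,
# stmt-AtomisticToContinuum-14870): almost surely the velocities stay pairwise distinct at all times

W1 of the pointwise engine. Under the local Gibbs law `P = localGibbsLaw σ a₀ u₀ θ₀ N Φ` there is a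
measurable set `S` with `P Sᶜ = 0` such that for every GOOD `z ∈ S` the velocities of `Φ.flow τ z` are
pairwise distinct for all `τ ∈ [0, t]` simultaneously.

Proof. (1) Fixed time: for every `s`, `P`-almost surely the velocities of `Φ.flow s z` are pairwise distinct
(`Clausius.ae_pairwise_vel_ne`: the coincidence hyperplanes are Liouville-null, the time-`s` map preserves
the Liouville measure and `P ≪` Liouville). (2) Countable reduction: `S := ⋂_{s ∈ I} D_s` over the
countable set of times `I = {t} ∪ ℚ`, where `D_s = {z | the velocities of Φ.flow s z are pairwise
distinct}` is measurable since `Φ.flow s` is; `P Sᶜ = 0` as a countable union of null sets. (3) All times: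
for good `z` the orbit is a hard-sphere trajectory, so every time `τ` is followed by a stretch
`[τ, τ + δ)` of free flight (`traj_freeFlight_right`), which does not move velocities; for `τ < t` pick a
rational `q ∈ (τ, min (τ + δ) t)` (`exists_rat_btwn`): the velocities at time `τ` are those at time `q`,
pairwise distinct since `z ∈ D_q`; the endpoint `τ = t` is covered by `D_t`.
-/

noncomputable section

open MeasureTheory Filter Set Topology InformationTheory
open scoped ENNReal ContDiff

namespace Summit.AtomisticToContinuum.HydrodynamicLimit.Theorems.MacroClosureLine

open Literature.MathematicalPhysics.KineticTheory Literature.Analysis.FluidPDE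
open Literature.Analysis.FunctionSpaces

namespace Barycentric

namespace EngineAeDistinct

variable {N : ℕ}

/-- The set of configurations whose image under a measurable map of phase space has pairwise distinct
velocities is measurable. -/
theorem measurableSet_distinct {f : Config (N + 1) (Fin 3) T3 → Config (N + 1) (Fin 3) T3}
    (hf : Measurable f) :
    MeasurableSet {z : Config (N + 1) (Fin 3) T3 |
      ∀ i j : Fin (N + 1), i ≠ j → ((f z) i).2 ≠ ((f z) j).2} := by
  refine measurableSet_setOf.2 (Measurable.forall fun i => Measurable.forall fun j =>
    measurable_const.imp ?_)
  exact (measurableSet_setOf.1 (measurableSet_eq_fun ((measurable_pi_apply i).comp hf).snd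
    ((measurable_pi_apply j).comp hf).snd)).not

/-- FIXED TIME: the local Gibbs law does not charge the configurations whose time-`s` image under the
flow has a velocity coincidence (`Clausius.ae_pairwise_vel_ne`). -/
theorem measure_compl_distinct {σ : ℝ} (a₀ : T3 → ℝ) (u₀ : T3 → V3) (θ₀ : T3 → ℝ) (Φ : Flow σ N)
    (s : ℝ) :
    localGibbsLaw σ a₀ u₀ θ₀ N Φ
      {z | ∀ i j : Fin (N + 1), i ≠ j → ((Φ.flow s z) i).2 ≠ ((Φ.flow s z) j).2}ᶜ = 0 := by
  have h := Clausius.ae_pairwise_vel_ne a₀ u₀ θ₀ Φ s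
  rw [ae_iff] at h
  simpa only [Set.compl_setOf] using h

/-- ALL TIMES ALONG A TRAJECTORY: on a hard-sphere trajectory, if the velocities are pairwise distinct at
time `t` and at every rational time, then they are pairwise distinct at every time `τ ≤ t` (free flight to
the right of `τ` up to a rational time). -/
theorem traj_vel_ne_of_rat {ε : ℝ} {γ : ℝ → Config (N + 1) (Fin 3) T3}
    (hγ : IsHardSphereTrajectory (Torus.geometry (Fin 3)) ε (N + 1) γ) {t : ℝ}
    (ht : ∀ i j : Fin (N + 1), i ≠ j → (γ t i).2 ≠ (γ t j).2)
    (hq : ∀ q : ℚ, ∀ i j : Fin (N + 1), i ≠ j → (γ q i).2 ≠ (γ q j).2) {τ : ℝ} (hτ : τ ≤ t)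
    {i j : Fin (N + 1)} (hij : i ≠ j) : (γ τ i).2 ≠ (γ τ j).2 := by
  rcases eq_or_lt_of_le hτ with rfl | hτt
  · exact ht i j hij
  · obtain ⟨δ, hδ, hflight⟩ := traj_freeFlight_right hγ τ
    obtain ⟨q, hτq, hqm⟩ := exists_rat_btwn (lt_min (lt_add_of_pos_right τ hδ) hτt)
    have hflow : γ q = freeFlight (Torus.geometry (Fin 3)) ((q : ℝ) - τ) (γ τ) :=
      hflight q ⟨hτq.le, (lt_min_iff.1 hqm).1⟩
    have hqD := hq q i j hij
    rw [hflow] at hqD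
    simpa only [freeFlight_apply] using hqD

end EngineAeDistinct

/-- **`engine_aeDistinct` (registered sub-goal W1 of `stub_engine`): almost surely distinct velocities at
all times.** Under the local Gibbs law there is a measurable set `S` of full measure such that for every
good `z ∈ S` the velocities of `Φ.flow τ z` are pairwise distinct for all `τ ∈ [0, t]` simultaneously
(fixed-time statement `Clausius.ae_pairwise_vel_ne` at the countably many times `{t} ∪ ℚ`, then free
flight to the right of every time along the hard-sphere trajectory of a good configuration). -/
theorem engine_aeDistinct : ∀ (σ : ℝ), 0 < σ → σ ≤ 1 / 2 → ∀ (a₀ θ₀ : T3 → ℝ) (u₀ : T3 → V3), Continuous a₀ → Continuous θ₀ → Continuous u₀ → (∀ x, 0 < a₀ x) → (∀ x, 0 < θ₀ x) → ∀ (N : ℕ) (Φ : Flow σ N) (t : ℝ), ∃ S : Set (Config (N + 1) (Fin 3) T3), MeasurableSet S ∧ localGibbsLaw σ a₀ u₀ θ₀ N Φ Sᶜ = 0 ∧ ∀ z ∈ S, z ∈ Φ.good → ∀ τ ∈ Icc 0 t, ∀ i j : Fin (N + 1), i ≠ j → (Φ.flow τ z i).2 ≠ (Φ.flow τ z j).2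 := by
  intro σ _ _ a₀ θ₀ u₀ _ _ _ _ _ N Φ t
  -- the countable set of test times `{t} ∪ ℚ`
  set I : Set ℝ := insert t (range ((↑) : ℚ → ℝ))
  have hIc : I.Countable := (countable_range _).insert t
  refine ⟨⋂ s ∈ I, {z | ∀ i j : Fin (N + 1), i ≠ j → ((Φ.flow s z) i).2 ≠ ((Φ.flow s z) j).2},
    MeasurableSet.biInter hIc fun s _ => EngineAeDistinct.measurableSet_distinct (Φ.measurable_flow s),
    ?_, ?_⟩
  · rw [compl_iInter₂]
    exact (measure_biUnion_null_iff hIc).2 fun s _ =>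
      EngineAeDistinct.measure_compl_distinct a₀ u₀ θ₀ Φ s
  · intro z hz hzg τ hτ i j hij
    have hzD : ∀ s ∈ I, ∀ i j : Fin (N + 1), i ≠ j → ((Φ.flow s z) i).2 ≠ ((Φ.flow s z) j).2 :=
      fun s hs => mem_iInter₂.1 hz s hs
    exact EngineAeDistinct.traj_vel_ne_of_rat (Φ.isTrajectory z hzg) (hzD t (mem_insert _ _))
      (fun q => hzD q (mem_insert_of_mem _ (mem_range_self q))) hτ.2 hij

end Barycentric

end Summit.AtomisticToContinuum.HydrodynamicLimit.Theorems.MacroClosureLine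

end
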